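import Summits.ValiantsHypothesis.ValiantsHypothesis.Cruxes.OrbitDimensionBound.Lines.PowerLadder

set_option linter.dupNamespace false

/-!
# F3 / BC5 witness for the rung `SquareShadow` (ladder `Lines/PowerLadder.lean`, forward rung g8)

The numeric family `PowerCovering k` (equivariant affine representations of `per_n ^ k`, covering bound with loss `k`)
specialises AT THE FLOOR'S PARAMETER `k = 1` to the proved floor `SubtorusCovering` — definitionally up to
`per_n ^ 1 = per_n` and `1 · x = x` — so the seed theorem `subtorusCovering_proof` proves the `k = 1` member by `simpa`,
and the `k = 1` shadow follows unconditionally.  The rung is the `k = 2` member (`SquareCovering` / `SquareShadow`), one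
notch up the SAME dial; it lies outside the Statement's known regime because no lower bound for (equivariant or not)
determinantal representations of POWERS of the permanent is in print (Landsberg–Ressayre treat `per_n` itself; von zur
Gathen's regularity, the engine of the floor, fails for `per_n ^ k`), and the Statement itself is open.
-/

namespace Summit.ValiantsHypothesis.ValiantsHypothesis.Cruxes.OrbitDimensionBound.Power

open Summit.ValiantsHypothesis.ValiantsHypothesis.Theorems.FreeSubtorusSubtorusCovering

/-- The family at the floor's parameter IS the floor: closed by the seed theorem. -/
example : PowerCovering 1 := by
  simpa [PowerCovering, Summit.ValiantsHypothesis.ValiantsHypothesis.Cruxes.OrbitDimensionBound.Degree.Admissible,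
    Summit.ValiantsHypothesis.ValiantsHypothesis.Cruxes.OrbitDimensionBound.Degree.torusGen,
    Summit.ValiantsHypothesis.ValiantsHypothesis.Theses.FreeSubtorus.SubtorusCovering] using subtorusCovering_proof

/-- The same, through the recorded `Iff` (`pow_one`, `one_mul`). -/
example : PowerCovering 1 := powerCovering_one_iff.mpr subtorusCovering_proof

/-- The shadow family at the floor's parameter, unconditionally (seed ⇒ numeric `k = 1` member ⇒ its shadow). -/
theorem powerShadow_one_special : PowerShadow 1 :=
  powerShadow_of_powerCovering (by
    simpa [PowerCovering, Summit.ValiantsHypothesis.ValiantsHypothesis.Cruxes.OrbitDimensionBound.Degree.Admissible,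
      Summit.ValiantsHypothesis.ValiantsHypothesis.Cruxes.OrbitDimensionBound.Degree.torusGen,
      Summit.ValiantsHypothesis.ValiantsHypothesis.Theses.FreeSubtorus.SubtorusCovering] using subtorusCovering_proof)

/-- And in the floor's own gauge: the `k = 1` shadow is the floor's shadow `CoveringShadow powLoss`. -/
example : Confusion.CoveringShadow Confusion.powLoss := powerShadow_one_iff.mp powerShadow_one_special

/-- The dial starts at the floor: the `k = 0` members are false. -/
example : ¬ PowerCovering 0 ∧ ¬ PowerShadow 0 := ⟨not_powerCovering_zero, not_powerShadow_zero⟩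

end Summit.ValiantsHypothesis.ValiantsHypothesis.Cruxes.OrbitDimensionBound.Power
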